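import Mathlib
import Summits.Ventures.PercRepro2.CoinTreeCore
import Summits.Ventures.PercRepro2.CoinOrTailKDefs
import Summits.Ventures.PercRepro2.CoinChainCover

/-!
# The chained OR-vertex with covering markers: an instantiation (blind cell PercRepro2,
night-2 g17; NIGHT2-DARC.md §57)

A coin system on `Fin 9` (s = 0, m₁ = 1, m₂ = 2, q = 3, a′ = 4, a = 5, w = 6, h = 7, t = 8) with
twelve coins: the out-tree core `s → m₁`, `s → m₂`, `m₁ → q`; the OR-vertex `a′` entered from
`m₁, m₂` (two RANDOM coins); the free-arc vertex `a` entered from `a′` (the chain arc, random)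
AND from `m₁` (random); the head `a′ → h`, `h → t`, `a → t`, `w → t`, `q → h`.  The core
`U ∪ {a′}` is not log-supermodular (the AND-switch of §56.1: `a′` has two entries).  Row 2′DARC
at `a → w` for the markers `(m₁, m₂)` for EVERY probability vector, no hypothesis
(`darc_chainCover_example`).
-/

namespace Summit.Ventures.PercRepro2.Coin

namespace ChainCoverExample

open Classical

/-- The twelve coins of the example. -/
def arcsCC : Fin 12 → Finset (Fin 9 × Fin 9)
  | 0 => {(0, 1)}   -- s → m₁
  | 1 => {(0, 2)}   -- s → m₂
  | 2 => {(1, 3)}   -- m₁ → q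
  | 3 => {(1, 4)}   -- m₁ → a′
  | 4 => {(2, 4)}   -- m₂ → a′
  | 5 => {(4, 5)}   -- a′ → a  (the chain arc)
  | 6 => {(1, 5)}   -- m₁ → a
  | 7 => {(4, 7)}   -- a′ → h
  | 8 => {(7, 8)}   -- h → t
  | 9 => {(5, 8)}   -- a → t
  | 10 => {(6, 8)}  -- w → t
  | 11 => {(3, 7)}  -- q → h
  | _ => ∅

/-- The entry coins of `a′`. -/
def c'CC : Fin 9 → Fin 12
  | 1 => 3
  | 2 => 4
  | _ => 0

/-- The entry coins of `a`. -/
def cCC : Fin 9 → Fin 12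
  | 4 => 5
  | 1 => 6
  | _ => 0

/-- The tree coins. -/
def tcCC : Fin 9 → Fin 12
  | 1 => 0
  | 2 => 1
  | 3 => 2
  | _ => 0

/-- The parent map. -/
def parCC : Fin 9 → Fin 9
  | 3 => 1
  | _ => 0

/-- The rank. -/
def rkCC : Fin 9 → ℕ
  | 1 => 1
  | 2 => 1
  | 3 => 2
  | _ => 0

/-- Every coin is a single arc. -/
lemma sameEnds_cc : SameEnds arcsCC := by
  intro e xy hxy x'y' hx'y'
  fin_cases e <;> simp [arcsCC] at hxy hx'y' <;> subst hxy <;> subst hx'y' <;>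
    exact ⟨Or.inl rfl, Or.inr rfl⟩

set_option maxRecDepth 20000 in
/-- The out-tree core `{m₁, m₂, q}`. -/
lemma treeCore_cc : TreeCore arcsCC 0 {1, 2, 3} tcCC parCC rkCC where
  tree := by decide
  par_mem := by decide
  rank := by decide
  into_C := by decide
  into_s := by decide
  s_notin := by decide

set_option maxRecDepth 20000 in
/-- `a′ = 4` is an OR-vertex of the core entered from `m₁, m₂`. -/
lemma orTailK'_cc : OrTailK arcsCC 0 {1, 2, 3} {1, 2} c'CC 4 where
  ent_sub := by decide
  s_notin := by decide
  a_notin := by decide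
  a_ne_s := by decide
  into_U := by decide
  into_s := by decide
  into_a := by decide
  arcs_c := by decide
  c_inj := by decide

set_option maxRecDepth 20000 in
/-- `a = 5` is an OR-vertex of `U ∪ {a′}` entered from `a′` and `m₁`. -/
lemma orTailK_cc : OrTailK arcsCC 0 (insert 4 {1, 2, 3}) {4, 1} cCC 5 where
  ent_sub := by decide
  s_notin := by decide
  a_notin := by decide
  a_ne_s := by decide
  into_U := by decide
  into_s := by decide
  into_a := by decide
  arcs_c := by decide
  c_inj := by decide

/-- **Row 2′DARC at `a → w` for the markers `(m₁, m₂)` on the twelve-coin chained instance,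
every probability vector — no hypothesis.** -/
theorem darc_chainCover_example {R : Type*} [Field R] [LinearOrder R] [IsStrictOrderedRing R]
    (pr : Fin 12 → R) (hp : IsProbVec pr) : DARC pr arcsCC 0 {8} 1 2 5 6 :=
  darc_of_chainTreeCover pr hp sameEnds_cc orTailK'_cc orTailK_cc treeCore_cc (by decide)
    (by decide) (by decide) (by decide) (by decide) (by decide) (by decide) (by decide)

end ChainCoverExample

end Summit.Ventures.PercRepro2.Coin
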